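import Summits.Ventures.PercRepro.C025ProfileGirthSuccSuccParts

/-!
# THE ROW `(q, q+2)` AT GIRTH `≥ q+1` — THE PRICE-PROPORTIONAL CERTIFICATE FOR THE GENERIC SETS (night-3 g20)

The generic half (G1) of the decomposition `profileIneq_succ_succ_of_parts` says `Σ_{B generic} price(B) ≤ #{clean
(q+2)-subsets}`.  Its HALL FORM (every sub-family) follows from the certificate that shares every clean set `U` among
its generic `q`-subsets PROPORTIONALLY TO PRICE: `w(B, U) = price(B) / P(U)`, `P(U) = Σ_{B' ⊆ U generic} price(B')`.
The capacity of every `U` is then exactly `1`, and the demand of `B` is `price(B) · Σ_{U ⊇ B clean} 1 / P(U)`, so the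
certificate works as soon as (PDEM) `Σ_{U ⊇ B clean} 1 / P(U) ≥ 1` for every priced generic `B` — which by the
AM–HM inequality follows from (AMHM) `Σ_{U ⊇ B clean} P(U) ≤ #{U ⊇ B clean}²`.
* `card_sq_le_sum_mul_sum_inv` — AM–HM: `#s² ≤ (Σ f) · (Σ 1/f)` for `f > 0` on `s`;
* **`sum_le_card_filter_of_prop_weights`** — the abstract certificate: for loaders `𝒢` with prices `p ≥ 0` and
  targets `𝒞`, (PDEM) gives `Σ_{B ∈ 𝒜} p(B) ≤ #{U ∈ 𝒞 : ∃ B ∈ 𝒜, B ⊆ U}` for every `𝒜 ⊆ 𝒢`;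
* `exists_clean_superset_of_indep` — every independent `q`-set has a clean `(q+2)`-superset (rank `≥ q + 2`);
* **`hallClean_of_amhm`** — (AMHM) gives the Hall form of (G1); **`genericIneq_of_amhm`** — (AMHM) gives (G1);
* **`profileIneq_succ_succ_of_amhm_of_fat`** — (AMHM) and (IF) give the row `(q, q+2)` of (Π) at girth `≥ q + 1`.
Own data (lab/prop2.c, every matroid of girth `≥ q + 1` and rank `≥ q + 3` on `≤ 9` elements): (AMHM) holds with `0`
violations at `q = 2` (6,837,238 priced generic sets) and `q = 3` (80,285), with equality on the free-like instances;
(PDEM) likewise (min `1.0000`; `1.1576` at `q = 2` with a fat flat).  HONEST LIMIT (lab/dsrule.py, direct sums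
`U_{q,N} ⊕ U_{f,f}` on up to 13 points): (PDEM) and (AMHM) hold for `q = 2, 3` but FAIL for `q = 4` (e.g. `U_{4,5} ⊕ U_{5,5}`,
`n = 10`: `Σ 1/P = 0.9714` for a generic set with three points in the fat flat) although the Hall form of (G1) itself
holds there by max-flow (lab/ds.py) — so the price-proportional certificate is the certificate of (G1) for `q ≤ 3` on
every instance tested, and a different weighting is needed for `q ≥ 4`.  No `def`, no `instance`, no notation.
-/

open scoped Matroid

namespace PercRepro

open Set Finset ThmH Staged

namespace GirthRows

/-- **AM–HM**: for `f > 0` on `s`, `#s² ≤ (Σ_{i ∈ s} f i) · (Σ_{i ∈ s} (f i)⁻¹)` — every ordered pair `(i, j)`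
contributes `f i / f j + f j / f i ≥ 2`. -/
theorem card_sq_le_sum_mul_sum_inv {ι : Type*} (s : Finset ι) (f : ι → ℚ) (hf : ∀ i ∈ s, 0 < f i) :
    ((s.card : ℚ)) ^ 2 ≤ (∑ i ∈ s, f i) * (∑ i ∈ s, (f i)⁻¹) := by
  have hpair : ∀ a b : ℚ, 0 < a → 0 < b → 2 ≤ a * b⁻¹ + b * a⁻¹ := by
    intro a b ha hb
    rw [← div_eq_mul_inv, ← div_eq_mul_inv, div_add_div _ _ hb.ne' ha.ne', le_div_iff₀ (mul_pos hb ha)]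
    nlinarith [sq_nonneg (a - b)]
  have hsum : ∀ i ∈ s, ∀ j ∈ s, 2 ≤ f i * (f j)⁻¹ + f j * (f i)⁻¹ :=
    fun i hi j hj => hpair _ _ (hf i hi) (hf j hj)
  have h1 : (∑ i ∈ s, f i) * (∑ i ∈ s, (f i)⁻¹) = ∑ i ∈ s, ∑ j ∈ s, f i * (f j)⁻¹ := Finset.sum_mul_sum s s f _
  have h2 : ∑ i ∈ s, ∑ j ∈ s, f i * (f j)⁻¹ = ∑ i ∈ s, ∑ j ∈ s, f j * (f i)⁻¹ := Finset.sum_comm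
  have h3 : 2 * ((s.card : ℚ)) ^ 2 ≤ ∑ i ∈ s, ∑ j ∈ s, (f i * (f j)⁻¹ + f j * (f i)⁻¹) := by
    calc 2 * ((s.card : ℚ)) ^ 2 = ∑ i ∈ s, ∑ _j ∈ s, (2 : ℚ) := by
          simp only [Finset.sum_const, nsmul_eq_mul]
          ring
      _ ≤ ∑ i ∈ s, ∑ j ∈ s, (f i * (f j)⁻¹ + f j * (f i)⁻¹) :=
          Finset.sum_le_sum (fun i hi => Finset.sum_le_sum (fun j hj => hsum i hi j hj))
  rw [Finset.sum_congr rfl (fun i _ => Finset.sum_add_distrib), Finset.sum_add_distrib, ← h2] at h3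
  linarith

/-- **The price-proportional certificate, abstractly.** Loaders `𝒢` with prices `p ≥ 0`, targets `𝒞`, and
`P U = Σ_{B ∈ 𝒢, B ⊆ U} p B`.  If every loader of positive price has `Σ_{U ∈ 𝒞, B ⊆ U} 1 / P U ≥ 1`, then for every
sub-family `𝒜 ⊆ 𝒢`, `Σ_{B ∈ 𝒜} p B ≤ #{U ∈ 𝒞 : some B ∈ 𝒜 lies in U}` — the weights `p B / P U` load every target by
at most `1`. -/
theorem sum_le_card_filter_of_prop_weights {α : Type*} [DecidableEq α] {𝒢 𝒞 : Finset (Finset α)}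
    {p : Finset α → ℚ} (hp : ∀ B ∈ 𝒢, 0 ≤ p B) {P : Finset α → ℚ}
    (hP : ∀ U, P U = ∑ B ∈ 𝒢 with B ⊆ U, p B)
    (hdem : ∀ B ∈ 𝒢, 0 < p B → 1 ≤ ∑ U ∈ 𝒞 with B ⊆ U, (P U)⁻¹)
    {𝒜 : Finset (Finset α)} (h𝒜 : 𝒜 ⊆ 𝒢) :
    ∑ B ∈ 𝒜, p B ≤ ((𝒞.filter (fun U => ∃ B ∈ 𝒜, B ⊆ U)).card : ℚ) := by
  classical
  -- step 1: each `p B` is at most `p B · Σ_{U ⊇ B} 1 / P U`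
  have hstep1 : ∑ B ∈ 𝒜, p B ≤ ∑ B ∈ 𝒜, ∑ U ∈ 𝒞 with B ⊆ U, p B * (P U)⁻¹ := by
    apply Finset.sum_le_sum
    intro B hB
    rw [← Finset.mul_sum]
    rcases (hp B (h𝒜 hB)).lt_or_eq with hpos | hzero
    · exact le_mul_of_one_le_right hpos.le (hdem B (h𝒜 hB) hpos)
    · rw [← hzero]
      simp only [zero_mul, le_refl]
  -- step 2: exchange the sums
  have hstep2 : ∑ B ∈ 𝒜, ∑ U ∈ 𝒞 with B ⊆ U, p B * (P U)⁻¹ =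
      ∑ U ∈ 𝒞, ∑ B ∈ 𝒜 with B ⊆ U, p B * (P U)⁻¹ := by
    rw [Finset.sum_comm' (t' := 𝒞) (s' := fun U => 𝒜.filter (fun B => B ⊆ U))]
    intro B U
    simp only [Finset.mem_filter]
    tauto
  -- step 3: every target carries load at most `1`, and `0` when no member of `𝒜` lies in it
  have hstep3 : ∑ U ∈ 𝒞, ∑ B ∈ 𝒜 with B ⊆ U, p B * (P U)⁻¹ ≤
      ∑ U ∈ 𝒞, (if ∃ B ∈ 𝒜, B ⊆ U then (1 : ℚ) else 0) := by
    apply Finset.sum_le_sum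
    intro U _
    rw [← Finset.sum_mul]
    have hPnn : 0 ≤ P U := by
      rw [hP U]
      exact Finset.sum_nonneg (fun B hB => hp B (Finset.mem_filter.1 hB).1)
    have hle : ∑ B ∈ 𝒜 with B ⊆ U, p B ≤ P U := by
      rw [hP U]
      apply Finset.sum_le_sum_of_subset_of_nonneg
      · intro B hB
        rw [Finset.mem_filter] at hB ⊢
        exact ⟨h𝒜 hB.1, hB.2⟩
      · intro B hB _
        exact hp B (Finset.mem_filter.1 hB).1
    split_ifs with hex
    · rcases hPnn.lt_or_eq with hpos | hzero
      · rw [← div_eq_mul_inv, div_le_one hpos]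
        exact hle
      · rw [← hzero, inv_zero, mul_zero]
        exact zero_le_one
    · have h0 : ∑ B ∈ 𝒜 with B ⊆ U, p B = 0 := by
        apply Finset.sum_eq_zero
        intro B hB
        rw [Finset.mem_filter] at hB
        exact absurd ⟨B, hB.1, hB.2⟩ hex
      rw [h0, zero_mul]
  rw [Finset.sum_boole] at hstep3
  exact hstep1.trans (hstep2.le.trans hstep3)

variable {α : Type} [DecidableEq α] {M : Matroid α} [M.Finite]

/-- Every independent `q`-subset of the ground set has a clean `(q+2)`-superset when `ρ(E) ≥ q + 2` (two points
outside successive closures give an independent, hence clean, `(q+2)`-set). -/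
theorem exists_clean_superset_of_indep {q : ℕ} (hrank : ((q + 2 : ℕ) : ℕ∞) ≤ M.eRank) {B : Finset α}
    (hBg : B ⊆ gr M) (hBc : B.card = q) (hBi : M.Indep (B : Set α)) :
    ∃ U ∈ (gr M).powersetCard (q + 2), B ⊆ U ∧ ∀ X ⊆ U, X.card = q + 1 → M.Indep (X : Set α) := by
  have hBr : rkN M B = q := by
    rw [Staged.rkN_eq_iff, hBi.eRk_eq_encard, Set.encard_coe_eq_coe_finsetCard, hBc]
  obtain ⟨y, hyg, hyc⟩ := exists_notMem_closure_of_rkN_eq hBr (le_trans (by exact_mod_cast (by omega : q + 1 ≤ q + 2)) hrank)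
  have hyB : y ∉ B := fun h => hyc (M.mem_closure_of_mem h (by rw [← coe_gr]; exact_mod_cast hBg))
  have h1i : M.Indep ((insert y B : Finset α) : Set α) := by
    rw [Finset.coe_insert, hBi.insert_indep_iff_of_notMem hyB]
    exact ⟨by rw [← coe_gr]; exact_mod_cast hyg, hyc⟩
  have h1r : rkN M (insert y B) = q + 1 := by rw [rkN_insert_of_notMem_closure hyg hyc, hBr]
  obtain ⟨y', hy'g, hy'c⟩ := exists_notMem_closure_of_rkN_eq h1r hrank
  have hy'1 : y' ∉ insert y B := fun h => hy'c (M.mem_closure_of_mem h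
    (by rw [← coe_gr]; exact_mod_cast Finset.insert_subset hyg hBg))
  have h2i : M.Indep ((insert y' (insert y B) : Finset α) : Set α) := by
    rw [Finset.coe_insert, h1i.insert_indep_iff_of_notMem hy'1]
    exact ⟨by rw [← coe_gr]; exact_mod_cast hy'g, hy'c⟩
  refine ⟨insert y' (insert y B), ?_, ?_, clean_of_indep h2i⟩
  · rw [Finset.mem_powersetCard]
    refine ⟨Finset.insert_subset hy'g (Finset.insert_subset hyg hBg), ?_⟩
    rw [Finset.card_insert_of_notMem hy'1, Finset.card_insert_of_notMem hyB, hBc]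
  · exact (Finset.subset_insert y B).trans (Finset.subset_insert y' _)

open scoped Classical in
/-- **THE HALL FORM OF (G1) FROM (AMHM).** Let `𝒢` be the generic sets of `Rq` (`q` points, closure adding no point
of `E`) and `𝒞` the clean `(q+2)`-subsets.  If for every priced generic `B` the total generic price of its clean
supersets is at most the square of their number, `Σ_{U ∈ 𝒞, B ⊆ U} P U ≤ #{U ∈ 𝒞 : B ⊆ U}²` with
`P U = Σ_{B' ∈ 𝒢, B' ⊆ U} price B'`, then for every sub-family `𝒜 ⊆ 𝒢`, `Σ_{B ∈ 𝒜} price B ≤ #{U ∈ 𝒞 : ∃ B ∈ 𝒜, B ⊆ U}`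
(rank `≥ q + 2`, girth `≥ q + 1`). -/
theorem hallClean_of_amhm {q : ℕ} (hg : ∀ T ⊆ M.E, T.encard ≤ q → M.Indep T)
    (hrank : ((q + 2 : ℕ) : ℕ∞) ≤ M.eRank)
    (hamhm : ∀ B ∈ (Profile.Rq M q).filter
        (fun B : Finset α => B.card = q ∧ ∀ x ∈ gr M, x ∈ M.closure (B : Set α) → x ∈ B),
      0 < Profile.price M q (q + 2) B →
      ∑ U ∈ ((gr M).powersetCard (q + 2)).filter
          (fun U : Finset α => ∀ X ⊆ U, X.card = q + 1 → M.Indep (X : Set α)) with B ⊆ U,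
        (∑ B' ∈ (Profile.Rq M q).filter
          (fun B : Finset α => B.card = q ∧ ∀ x ∈ gr M, x ∈ M.closure (B : Set α) → x ∈ B) with B' ⊆ U,
          Profile.price M q (q + 2) B') ≤
      (((((gr M).powersetCard (q + 2)).filter
          (fun U : Finset α => ∀ X ⊆ U, X.card = q + 1 → M.Indep (X : Set α))).filter
          (fun U => B ⊆ U)).card : ℚ) ^ 2)
    {𝒜 : Finset (Finset α)}
    (h𝒜 : 𝒜 ⊆ (Profile.Rq M q).filter
        (fun B : Finset α => B.card = q ∧ ∀ x ∈ gr M, x ∈ M.closure (B : Set α) → x ∈ B)) :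
    ∑ B ∈ 𝒜, Profile.price M q (q + 2) B ≤
      (((((gr M).powersetCard (q + 2)).filter
          (fun U : Finset α => ∀ X ⊆ U, X.card = q + 1 → M.Indep (X : Set α))).filter
          (fun U => ∃ B ∈ 𝒜, B ⊆ U)).card : ℚ) := by
  set 𝒢 := (Profile.Rq M q).filter
    (fun B : Finset α => B.card = q ∧ ∀ x ∈ gr M, x ∈ M.closure (B : Set α) → x ∈ B) with h𝒢
  set 𝒞 := ((gr M).powersetCard (q + 2)).filter
    (fun U : Finset α => ∀ X ⊆ U, X.card = q + 1 → M.Indep (X : Set α)) with h𝒞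
  refine sum_le_card_filter_of_prop_weights (𝒢 := 𝒢) (𝒞 := 𝒞) (p := Profile.price M q (q + 2))
    (fun B _ => Profile.price_nonneg _ _ _)
    (P := fun U => ∑ B' ∈ 𝒢 with B' ⊆ U, Profile.price M q (q + 2) B') (fun U => rfl) ?_ h𝒜
  intro B hB hpos
  -- the clean supersets of `B`
  set s := 𝒞.filter (fun U => B ⊆ U) with hs
  have hBmem := hB
  rw [h𝒢, Finset.mem_filter, Profile.mem_Rq] at hBmem
  obtain ⟨⟨hBg, hBr⟩, hBc, _⟩ := hBmem
  have hBi : M.Indep (B : Set α) := by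
    apply hg _ (by rw [← coe_gr]; exact_mod_cast hBg)
    rw [Set.encard_coe_eq_coe_finsetCard, hBc]
  -- `s` is nonempty
  obtain ⟨U₀, hU₀, hBU₀, hU₀c⟩ := exists_clean_superset_of_indep hrank hBg hBc hBi
  have hU₀s : U₀ ∈ s := by
    rw [hs, Finset.mem_filter, h𝒞, Finset.mem_filter]
    exact ⟨⟨hU₀, hU₀c⟩, hBU₀⟩
  have hcard : 1 ≤ s.card := Finset.card_pos.2 ⟨U₀, hU₀s⟩
  -- `P U > 0` on `s`
  have hPpos : ∀ U ∈ s, 0 < ∑ B' ∈ 𝒢 with B' ⊆ U, Profile.price M q (q + 2) B' := by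
    intro U hU
    rw [hs, Finset.mem_filter] at hU
    apply lt_of_lt_of_le hpos
    apply Finset.single_le_sum (fun B' _ => Profile.price_nonneg _ _ _)
    rw [Finset.mem_filter]
    exact ⟨hB, hU.2⟩
  have hamhm' := hamhm B hB hpos
  have hAM := card_sq_le_sum_mul_sum_inv s _ hPpos
  have hsumpos : 0 < ∑ U ∈ s, ∑ B' ∈ 𝒢 with B' ⊆ U, Profile.price M q (q + 2) B' :=
    lt_of_lt_of_le (hPpos U₀ hU₀s) (Finset.single_le_sum (fun U hU => (hPpos U hU).le) hU₀s)
  have hcardq : (1 : ℚ) ≤ (s.card : ℚ) := by exact_mod_cast hcard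
  -- `#s² ≤ (Σ P) (Σ P⁻¹) ≤ #s² (Σ P⁻¹)`, so `Σ P⁻¹ ≥ 1`
  have hkey : ((s.card : ℚ)) ^ 2 ≤ ((s.card : ℚ)) ^ 2 * ∑ U ∈ s, (∑ B' ∈ 𝒢 with B' ⊆ U, Profile.price M q (q + 2) B')⁻¹ := by
    calc ((s.card : ℚ)) ^ 2 ≤ (∑ U ∈ s, ∑ B' ∈ 𝒢 with B' ⊆ U, Profile.price M q (q + 2) B') *
          (∑ U ∈ s, (∑ B' ∈ 𝒢 with B' ⊆ U, Profile.price M q (q + 2) B')⁻¹) := hAM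
      _ ≤ ((s.card : ℚ)) ^ 2 * ∑ U ∈ s, (∑ B' ∈ 𝒢 with B' ⊆ U, Profile.price M q (q + 2) B')⁻¹ := by
          apply mul_le_mul_of_nonneg_right hamhm'
          exact Finset.sum_nonneg (fun U hU => (inv_pos.2 (hPpos U hU)).le)
  have hsq : (0 : ℚ) < ((s.card : ℚ)) ^ 2 := by positivity
  have hkey' : ((s.card : ℚ)) ^ 2 * 1 ≤ ((s.card : ℚ)) ^ 2 *
      ∑ U ∈ s, (∑ B' ∈ 𝒢 with B' ⊆ U, Profile.price M q (q + 2) B')⁻¹ := by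
    rw [mul_one]
    exact hkey
  exact le_of_mul_le_mul_left hkey' hsq

open scoped Classical in
/-- **(G1) FROM (AMHM)**: `Σ_{B generic} price(B) ≤ #{clean (q+2)-subsets}` — the Hall form with the full family. -/
theorem genericIneq_of_amhm {q : ℕ} (hg : ∀ T ⊆ M.E, T.encard ≤ q → M.Indep T)
    (hrank : ((q + 2 : ℕ) : ℕ∞) ≤ M.eRank)
    (hamhm : ∀ B ∈ (Profile.Rq M q).filter
        (fun B : Finset α => B.card = q ∧ ∀ x ∈ gr M, x ∈ M.closure (B : Set α) → x ∈ B),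
      0 < Profile.price M q (q + 2) B →
      ∑ U ∈ ((gr M).powersetCard (q + 2)).filter
          (fun U : Finset α => ∀ X ⊆ U, X.card = q + 1 → M.Indep (X : Set α)) with B ⊆ U,
        (∑ B' ∈ (Profile.Rq M q).filter
          (fun B : Finset α => B.card = q ∧ ∀ x ∈ gr M, x ∈ M.closure (B : Set α) → x ∈ B) with B' ⊆ U,
          Profile.price M q (q + 2) B') ≤
      (((((gr M).powersetCard (q + 2)).filter
          (fun U : Finset α => ∀ X ⊆ U, X.card = q + 1 → M.Indep (X : Set α))).filter
          (fun U => B ⊆ U)).card : ℚ) ^ 2) :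
    ∑ B ∈ (Profile.Rq M q).filter
        (fun B : Finset α => B.card = q ∧ ∀ x ∈ gr M, x ∈ M.closure (B : Set α) → x ∈ B),
        Profile.price M q (q + 2) B ≤
      ((((gr M).powersetCard (q + 2)).filter
        (fun U : Finset α => ∀ X ⊆ U, X.card = q + 1 → M.Indep (X : Set α))).card : ℚ) := by
  refine le_trans (hallClean_of_amhm hg hrank hamhm (Finset.Subset.refl _)) ?_
  exact_mod_cast Finset.card_le_card (Finset.filter_subset _ _)

open scoped Classical in
/-- **THE ROW `(q, q+2)` OF (Π) AT GIRTH `≥ q + 1` FROM (AMHM) AND (IF)** (rank `≥ q + 3`): the generic sets through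
the price-proportional certificate, the inner and fat sets through (IF). -/
theorem profileIneq_succ_succ_of_amhm_of_fat {q : ℕ} (hg : ∀ T ⊆ M.E, T.encard ≤ q → M.Indep T)
    (hrank : ((q + 3 : ℕ) : ℕ∞) ≤ M.eRank)
    (hamhm : ∀ B ∈ (Profile.Rq M q).filter
        (fun B : Finset α => B.card = q ∧ ∀ x ∈ gr M, x ∈ M.closure (B : Set α) → x ∈ B),
      0 < Profile.price M q (q + 2) B →
      ∑ U ∈ ((gr M).powersetCard (q + 2)).filter
          (fun U : Finset α => ∀ X ⊆ U, X.card = q + 1 → M.Indep (X : Set α)) with B ⊆ U,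
        (∑ B' ∈ (Profile.Rq M q).filter
          (fun B : Finset α => B.card = q ∧ ∀ x ∈ gr M, x ∈ M.closure (B : Set α) → x ∈ B) with B' ⊆ U,
          Profile.price M q (q + 2) B') ≤
      (((((gr M).powersetCard (q + 2)).filter
          (fun U : Finset α => ∀ X ⊆ U, X.card = q + 1 → M.Indep (X : Set α))).filter
          (fun U => B ⊆ U)).card : ℚ) ^ 2)
    (hIF : ∑ B ∈ (Profile.Rq M q).filter
        (fun B : Finset α => ¬ (B.card = q ∧ ∀ x ∈ gr M, x ∈ M.closure (B : Set α) → x ∈ B)),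
        Profile.price M q (q + 2) B ≤
      (((Shadow.levelSet M (q + 2)).filter
        (fun S : Finset α => ¬ ∀ X ⊆ S, X.card = q + 1 → M.Indep (X : Set α))).card : ℚ)) :
    Profile.ProfileIneq M q (q + 2) :=
  profileIneq_succ_succ_of_parts hg hrank
    (genericIneq_of_amhm hg (le_trans (by exact_mod_cast (by omega : q + 2 ≤ q + 3)) hrank) hamhm) hIF

end GirthRows

end PercRepro
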